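import Summits.BirchSwinnertonDyer.Rank1Residual.X12.J1728TamagawaThree
import Summits.BirchSwinnertonDyer.Rank1Residual.X12.JZeroRedThree
import HarnessLib

/-!
# Tate's algorithm on `y² = x³ + b` at a place `v ∤ 6`: Kodaira types `II, IV, I₀*, IV*, II*`;
# the Kodaira type of every `j = 0` curve at every place `v ∤ 6`

HONEST FRAMING (cell `b2b-bsdres`, run/shared/lean/b2b/bsd-rank1-residual/, verbatim in every
file): the goal of the cell is to DELETE the COMBINATION-SHAPED residual classes of the
Birch–Swinnerton-Dyer formula for ALL analytic-rank `≤ 1` elliptic curves over `ℚ` — "full BSD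
formula for every rank `≤ 1` curve in class `C`" assembled STRICTLY from published theorems — so
that the rank-`≤ 1` remainder becomes exactly the CONSTRUCTION-SHAPED classes, which are TYPED
(missing-input `Prop`s), NOT attempted. This is not "finishing BSD". Unit `b2b-bsdres-x1b` (X12
prover owner), generation 23; research route, no claim beyond the stated class; X12 REMAINS
CONSTRUCTION-SHAPED; nothing is booked here — booking is the lane's and the referee's.

Theorems only; no definition, no new named fact. This file is the kernel form of one row of the
CLASS-CLOSURE lane's E2 SUB-PARTITION of the X12 corner (HOME `CLASS-CLOSURE-PLAN.md` §3.14): at an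
odd bad prime `p ≥ 5` of a CM curve with `j = 0` (`K = ℚ(√−3)`, `p ≡ 2 (3)` inert) the reduction
is additive potentially good of Kodaira type `II, IV, I₀*, IV*` or `II*` — semistability defect
`e = 6, 3, 2, 3, 6` — read off `ord_p` of the constant coefficient of a model `y² = x³ + b`.

§1 engine `kodairaSymbolAt_of_cubic_model`: TATE'S ALGORITHM run in the kernel at a place `v ∤ 6`
on a `ℚ`-model `M = D • W = (y² = x³ + b)` with `ord_v b = s ∈ {1, …, 5}` (Silverman *ATAEC*
IV.9.4: `b₂ = b₄ = b₈ = 0`, `b₆ = 4b`, `Δ = −432 b²`, so the model is minimal, `ord_v Δ = 2s < 12`,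
*AEC* VII.1 Rem. 1.1; Step 3: `π² ∤ a₆` ⟹ `II`; Step 5: `π³ ∤ b₆` ⟹ `IV`; Step 6: the cubic
`T³ + b/π³` has three distinct roots in `k̄` as `3 ≠ 0` in `k` ⟹ `I₀*`; Step 8: `Y² − b/π⁴` has two
distinct roots as `2 ≠ 0` ⟹ `IV*`; Step 10: `π⁶ ∤ a₆` ⟹ `II*`; tree lemmas
`kodairaSymbolOfMinimal_eq_II_of_step2 / _IV_of_step2 / _Istar_zero_of_step6 / _IVstar_of_step8 /
_IIstar_of_step9`), the sibling of gen 22's quartic engine `kodairaSymbolAt_of_quartic_model`.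
§2 `hasGoodReductionAt_or_kodairaSymbolAt_of_j_eq_zero`: for EVERY elliptic curve over `ℚ` with
`j = 0` and every place `v ∤ 6`, either good reduction at `v` or Kodaira type `II, IV, I₀*, IV*, II*`
(short model `y² = x³ + B`, `a₄ = 0` by `a₄_eq_zero_of_isShortNF_of_j_eq_zero`, rescaled by
`ℓ^{6k}`, `ℓ` the residue characteristic, to `ord_v b ∈ {0, …, 5}`).

Not claimed: places over `2` and `3` (wild; the `j = 0` curves have their CM-ramified prime there);
anything about BSD.

References: [SilvermanATAEC1994] IV.9.4 Steps 1–10, Table 4.1; [SilvermanAEC2009] VII.1 Rem. 1.1,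
III.1; HOME `b2b-bsdres-x1b/X12-ROUTE.md` §27, `CLASS-CLOSURE-PLAN.md` §3.14.
-/

noncomputable section

open scoped Classical NumberField

open WeierstrassCurve NumberField IsDedekindDomain IsDedekindDomain.HeightOneSpectrum Field
  Rat.HeightOneSpectrum Literature.NumberTheory.EllipticCurves
  Literature.NumberTheory.GaloisRepresentations
  Literature.NumberTheory.EllipticCurves.ModularForms
  Literature.NumberTheory.EllipticCurves.Rank1Residual
  Literature.NumberTheory.EllipticCurves.Rank1Residual.Typed
  Literature.NumberTheory.Automorphic
  Literature.NumberTheory.DiophantineGeometry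
  Literature.NumberTheory.DiophantineGeometry.TateAlgorithm
  Polynomial

namespace Summit.BirchSwinnertonDyer.Rank1Residual.X12

/-- An element of `O_v` of valuation exactly `exp(-n)` is not divisible by `ϖⁿ⁺¹`. [folklore] -/
private theorem not_pow_succ_dvd_of_valued_eq_cubic (v : HeightOneSpectrum (𝓞 ℚ))
    {x : v.adicCompletionIntegers ℚ} {n : ℕ}
    (h : Valued.v (x : v.adicCompletion ℚ) = WithZero.exp (-(n : ℤ))) :
    ¬ uniformizer (v.adicCompletionIntegers ℚ) ^ (n + 1) ∣ x := by
  have hϖ : Irreducible (uniformizer (v.adicCompletionIntegers ℚ)) := irreducible_uniformizer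
  obtain ⟨u, hu, hx⟩ := exists_isUnit_eq_uniformizer_pow_mul_of_valued_eq v h
  rintro ⟨c, hc⟩
  rw [hx, pow_succ, mul_assoc] at hc
  have hc' : u = uniformizer (v.adicCompletionIntegers ℚ) * c :=
    mul_left_cancel₀ (pow_ne_zero n hϖ.ne_zero) hc
  exact hϖ.not_isUnit (isUnit_of_mul_isUnit_left (hc' ▸ hu))

/-- Scaling `(u; 0, 0, 0)` of `y² = x³ + b`: `y² = x³ + b/u⁶`. [folklore] -/
theorem smul_cubic_scale (u : ℚˣ) (b : ℚ) :
    (⟨u, 0, 0, 0⟩ : VariableChange ℚ) • (⟨0, 0, 0, 0, b⟩ : WeierstrassCurve ℚ) =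
      ⟨0, 0, 0, 0, (u⁻¹ : ℚˣ) ^ 6 * b⟩ := by
  ext <;> simp [variableChange_a₁, variableChange_a₂, variableChange_a₃, variableChange_a₄,
    variableChange_a₆]

/-! ### §1 Engine: Tate's algorithm on `y² = x³ + b` at a place `v ∤ 6` with `ord_v b ∈ {1, …, 5}` -/

/-- **Tate's algorithm on `y² = x³ + b` at a finite place `v ∤ 6`: `ord_v b = 1, 2, 3, 4, 5` give
Kodaira types `II`, `IV`, `I₀*`, `IV*`, `II*`** (for a `ℚ`-model `M = D • W = (y² = x³ + b)`,
`v(b) = exp(-s)`; minimal at `v` since `ord_v Δ = 2s < 12`, *AEC* VII.1 Rem. 1.1; Steps 3 / 5 / 6 / 8 /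
10 of *ATAEC* IV.9.4 via `kodairaSymbolOfMinimal_eq_II_of_step2 / _IV_of_step2 / _Istar_zero_of_step6 /
_IVstar_of_step8 / _IIstar_of_step9`).
[cite: SilvermanATAEC1994, IV.9.4 Steps 1–10 (PDF pp. 344–346) and Table 4.1]
[cite: SilvermanAEC2009, VII.1 Remark 1.1] -/
theorem kodairaSymbolAt_of_cubic_model (W : WeierstrassCurve ℚ) [W.IsElliptic]
    (v : HeightOneSpectrum (𝓞 ℚ)) (hv2 : natGenerator v ≠ 2) (hv3 : natGenerator v ≠ 3)
    (M : WeierstrassCurve ℚ) (D : VariableChange ℚ) (hM : M = D • W) {b : ℚ}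
    (hMb : M = ⟨0, 0, 0, 0, b⟩) {s : ℕ} (hs1 : 1 ≤ s) (hs5 : s ≤ 5)
    (hb : v.valuation ℚ b = WithZero.exp (-(s : ℤ))) :
    W.kodairaSymbolAt v =
      if s = 1 then .II else if s = 2 then .IV else if s = 3 then .Istar 0
      else if s = 4 then .IVstar else .IIstar := by
  haveI := perfectField_residueField_adicCompletionIntegers (K := ℚ) v
  haveI hMell : M.IsElliptic := by rw [hM]; infer_instance
  have hp2 : ¬ (natGenerator v : ℤ) ∣ 2 := fun h ↦ hv2 <| by
    have h' : natGenerator v ∣ 2 := by exact_mod_cast h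
    exact (Nat.prime_dvd_prime_iff_eq (prime_natGenerator v) Nat.prime_two).mp h'
  have hp3 : ¬ (natGenerator v : ℤ) ∣ 3 := fun h ↦ hv3 <| by
    have h' : natGenerator v ∣ 3 := by exact_mod_cast h
    exact (Nat.prime_dvd_prime_iff_eq (prime_natGenerator v) Nat.prime_three).mp h'
  have h2 : v.valuation ℚ (2 : ℚ) = 1 := by
    have := Rat.valuation_intCast_eq_one v hp2; exact_mod_cast this
  have h3 : v.valuation ℚ (3 : ℚ) = 1 := by
    have := Rat.valuation_intCast_eq_one v hp3; exact_mod_cast this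
  have h432 : v.valuation ℚ (432 : ℚ) = 1 := by
    rw [show (432 : ℚ) = 2 ^ 4 * 3 ^ 3 by norm_num, map_mul, map_pow, map_pow, h2, h3, one_pow,
      one_pow, one_mul]
  have h4 : v.valuation ℚ (4 : ℚ) = 1 := by
    rw [show (4 : ℚ) = 2 ^ 2 by norm_num, map_pow, h2, one_pow]
  have hc2 : ringChar (𝓞 ℚ ⧸ v.asIdeal) ≠ 2 := by
    rw [X2.ringChar_quot_asIdeal_eq_primesEquiv]; exact hv2
  have hc3 : ringChar (𝓞 ℚ ⧸ v.asIdeal) ≠ 3 := by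
    rw [X2.ringChar_quot_asIdeal_eq_primesEquiv]; exact hv3
  -- the coefficients of `M`
  have e₁ : M.a₁ = 0 := by rw [hMb]
  have e₂ : M.a₂ = 0 := by rw [hMb]
  have e₃ : M.a₃ = 0 := by rw [hMb]
  have e₄ : M.a₄ = 0 := by rw [hMb]
  have e₆ : M.a₆ = b := by rw [hMb]
  have eb₂ : M.b₂ = 0 := by rw [hMb]; simp [WeierstrassCurve.b₂]
  have eb₆ : M.b₆ = 4 * b := by rw [hMb]; simp [WeierstrassCurve.b₆]
  have eb₈ : M.b₈ = 0 := by rw [hMb]; simp [WeierstrassCurve.b₈]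
  have eΔ : M.Δ = -(432 : ℚ) * b ^ 2 := by
    rw [hMb]; simp only [WeierstrassCurve.Δ, WeierstrassCurve.b₂, WeierstrassCurve.b₄,
      WeierstrassCurve.b₆, WeierstrassCurve.b₈]; ring
  have hexp1 : WithZero.exp (-(s : ℤ)) ≤ (1 : WithZero (Multiplicative ℤ)) := by
    rw [← WithZero.exp_zero, WithZero.exp_le_exp]; omega
  -- integrality and minimality of `X = M ⊗ ℚ_v`
  have hint : M.IsIntegralAt v :=
    M.isIntegralAt_of_valuation_le_one v (by rw [e₁, map_zero]; exact zero_le_one)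
      (by rw [e₂, map_zero]; exact zero_le_one) (by rw [e₃, map_zero]; exact zero_le_one)
      (by rw [e₄, map_zero]; exact zero_le_one) (by rw [e₆, hb]; exact hexp1)
  have hΔ : v.valuation ℚ M.Δ = WithZero.exp (-((2 * s : ℕ) : ℤ)) := by
    rw [eΔ, map_mul, Valuation.map_neg, h432, one_mul, map_pow, hb, ← WithZero.exp_nsmul]
    congr 1; push_cast; ring
  have hmin : M.IsMinimalAt v :=
    isMinimalAt_of_lt_valuation_Δ_holds hint (by rw [hΔ]; exact WithZero.exp_lt_exp.mpr (by omega))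
  set X := M.baseChange (v.adicCompletion ℚ) with hX
  haveI hXint : X.IsIntegral (v.adicCompletionIntegers ℚ) := hint
  haveI hXmin : X.IsMinimal (v.adicCompletionIntegers ℚ) := hmin
  haveI hXell : X.IsElliptic := by rw [hX, WeierstrassCurve.baseChange]; infer_instance
  set I := X.integralModel (v.adicCompletionIntegers ℚ) with hI
  -- valuations of the coefficients of the `O_v`-model
  have hva : ∀ (x : v.adicCompletionIntegers ℚ) (q : ℚ),
      algebraMap (v.adicCompletionIntegers ℚ) (v.adicCompletion ℚ) x =
        algebraMap ℚ (v.adicCompletion ℚ) q →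
      Valued.v (x : v.adicCompletion ℚ) = v.valuation ℚ q := by
    intro x q h
    rw [show (x : v.adicCompletion ℚ) = algebraMap _ (v.adicCompletion ℚ) x from rfl, h,
      WeierstrassCurve.valued_algebraMap_adicCompletion]
  have hIa₁ : Valued.v ((I.a₁ : v.adicCompletionIntegers ℚ) : v.adicCompletion ℚ) = 0 := by
    rw [hva _ _ (by rw [hI, integralModel_a₁_eq, hX, WeierstrassCurve.baseChange, map_a₁]), e₁,
      map_zero]
  have hIa₂ : Valued.v ((I.a₂ : v.adicCompletionIntegers ℚ) : v.adicCompletion ℚ) = 0 := by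
    rw [hva _ _ (by rw [hI, integralModel_a₂_eq, hX, WeierstrassCurve.baseChange, map_a₂]), e₂,
      map_zero]
  have hIa₃ : Valued.v ((I.a₃ : v.adicCompletionIntegers ℚ) : v.adicCompletion ℚ) = 0 := by
    rw [hva _ _ (by rw [hI, integralModel_a₃_eq, hX, WeierstrassCurve.baseChange, map_a₃]), e₃,
      map_zero]
  have hIa₄ : Valued.v ((I.a₄ : v.adicCompletionIntegers ℚ) : v.adicCompletion ℚ) = 0 := by
    rw [hva _ _ (by rw [hI, integralModel_a₄_eq, hX, WeierstrassCurve.baseChange, map_a₄]), e₄,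
      map_zero]
  have hIa₆ : Valued.v ((I.a₆ : v.adicCompletionIntegers ℚ) : v.adicCompletion ℚ) =
      WithZero.exp (-(s : ℤ)) := by
    rw [hva _ _ (by rw [hI, integralModel_a₆_eq, hX, WeierstrassCurve.baseChange, map_a₆]), e₆, hb]
  have hIb₂ : Valued.v ((I.b₂ : v.adicCompletionIntegers ℚ) : v.adicCompletion ℚ) = 0 := by
    rw [hva _ _ (by rw [hI, integralModel_b₂_eq, hX, WeierstrassCurve.baseChange, map_b₂]), eb₂,
      map_zero]
  have hIb₆ : Valued.v ((I.b₆ : v.adicCompletionIntegers ℚ) : v.adicCompletion ℚ) =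
      WithZero.exp (-(s : ℤ)) := by
    rw [hva _ _ (by rw [hI, integralModel_b₆_eq, hX, WeierstrassCurve.baseChange, map_b₆]), eb₆,
      map_mul, h4, one_mul, hb]
  have hIb₈ : Valued.v ((I.b₈ : v.adicCompletionIntegers ℚ) : v.adicCompletion ℚ) = 0 := by
    rw [hva _ _ (by rw [hI, integralModel_b₈_eq, hX, WeierstrassCurve.baseChange, map_b₈]), eb₈,
      map_zero]
  have hIΔ : Valued.v ((I.Δ : v.adicCompletionIntegers ℚ) : v.adicCompletion ℚ) =
      WithZero.exp (-((2 * s : ℕ) : ℤ)) := by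
    rw [← hΔ]
    exact hva _ _ (by rw [hI, integralModel_Δ_eq, hX, WeierstrassCurve.baseChange, map_Δ])
  -- divisibilities on the `O_v`-model
  set ϖ := uniformizer (v.adicCompletionIntegers ℚ) with hϖ
  have dvdk : ∀ {x : v.adicCompletionIntegers ℚ} (k : ℕ),
      Valued.v (x : v.adicCompletion ℚ) ≤ WithZero.exp (-(k : ℤ)) → ϖ ^ k ∣ x := fun {x} k hx ↦
    uniformizer_pow_dvd_of_valued_le v (x := x) (n := k) hx
  have dvd0 : ∀ {x : v.adicCompletionIntegers ℚ} (k : ℕ),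
      Valued.v (x : v.adicCompletion ℚ) = 0 → ϖ ^ k ∣ x := fun {x} k hx ↦
    dvdk k (by rw [hx]; exact zero_le)
  have dvd0' : ∀ {x : v.adicCompletionIntegers ℚ},
      Valued.v (x : v.adicCompletion ℚ) = 0 → ϖ ∣ x := fun {x} hx ↦ by
    have := dvd0 (x := x) 1 hx; rwa [pow_one] at this
  have ha₆k : ∀ k : ℕ, k ≤ s → ϖ ^ k ∣ I.a₆ := fun k hk ↦
    dvdk k (by rw [hIa₆]; exact WithZero.exp_le_exp.mpr (by omega))
  have ha₆n : ¬ ϖ ^ (s + 1) ∣ I.a₆ := not_pow_succ_dvd_of_valued_eq_cubic v hIa₆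
  have hb₆n : ¬ ϖ ^ (s + 1) ∣ I.b₆ := not_pow_succ_dvd_of_valued_eq_cubic v hIb₆
  -- `2, 3` are units of `O_v`, hence nonzero in the residue field
  have hu2 : IsUnit (2 : v.adicCompletionIntegers ℚ) :=
    HeightOneSpectrum.isUnit_two_adicCompletionIntegers ℚ v hc2
  have hu3 : IsUnit (3 : v.adicCompletionIntegers ℚ) :=
    HeightOneSpectrum.isUnit_three_adicCompletionIntegers ℚ v hc3
  have h2k : (2 : IsLocalRing.ResidueField (v.adicCompletionIntegers ℚ)) ≠ 0 := residue_two_ne_zero hu2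
  have h3k : (3 : IsLocalRing.ResidueField (v.adicCompletionIntegers ℚ)) ≠ 0 := residue_three_ne_zero hu3
  -- Tate's algorithm
  have hK : I.kodairaSymbolOfMinimal =
      if s = 1 then .II else if s = 2 then .IV else if s = 3 then .Istar 0
      else if s = 4 then .IVstar else .IIstar := by
    have nΔ : ϖ ∣ I.Δ := by
      have := dvdk (x := I.Δ) 1 (by rw [hIΔ]; exact WithZero.exp_le_exp.mpr (by omega))
      rwa [pow_one] at this
    have n3 : ϖ ∣ I.a₃ := dvd0' hIa₃
    have n4 : ϖ ∣ I.a₄ := dvd0' hIa₄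
    have n6 : ϖ ∣ I.a₆ := by have := ha₆k 1 hs1; rwa [pow_one] at this
    have nb₂ : ϖ ∣ I.b₂ := dvd0' hIb₂
    rcases (show s = 1 ∨ s = 2 ∨ s = 3 ∨ s = 4 ∨ s = 5 by omega) with rfl | rfl | rfl | rfl | rfl
    · -- `s = 1`: type `II` (Step 3)
      rw [if_pos rfl]
      refine kodairaSymbolOfMinimal_eq_II_of_step2 nΔ n3 n4 n6 nb₂ ?_
      exact not_pow_succ_dvd_of_valued_eq_cubic v (n := 1) hIa₆
    · -- `s = 2`: type `IV` (Step 5)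
      rw [if_neg (by norm_num), if_pos rfl]
      exact kodairaSymbolOfMinimal_eq_IV_of_step2 nΔ n3 n4 n6 nb₂ (ha₆k 2 le_rfl) (dvd0 3 hIb₈) hb₆n
    · -- `s = 3`: type `I₀*` (Step 6)
      rw [if_neg (by norm_num), if_neg (by norm_num), if_pos rfl]
      refine kodairaSymbolOfMinimal_eq_Istar_zero_of_step6 (dvd0' hIa₁) (dvd0' hIa₂) (dvd0 2 hIa₃)
        (dvd0 2 hIa₄) (ha₆k 3 le_rfl) ?_
      have hr : redCoeff I.a₆ 3 ≠ 0 := fun h0 ↦ ha₆n ((redCoeff_eq_zero_iff (ha₆k 3 le_rfl)).mp h0)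
      rw [cubicStep6, redCoeff_eq_zero_of_dvd (j := 1) (dvd0 2 hIa₂),
        redCoeff_eq_zero_of_dvd (j := 2) (dvd0 3 hIa₄), distinctRootCount_cubic_eq_three_iff]
      intro hdisc
      have h27 : (27 : IsLocalRing.ResidueField (v.adicCompletionIntegers ℚ)) ≠ 0 := by
        rw [show (27 : IsLocalRing.ResidueField (v.adicCompletionIntegers ℚ)) = 3 ^ 3 by norm_num]
        exact pow_ne_zero 3 h3k
      have : (27 : IsLocalRing.ResidueField (v.adicCompletionIntegers ℚ)) * redCoeff I.a₆ 3 ^ 2 = 0 := by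
        linear_combination -hdisc
      rcases mul_eq_zero.mp this with h | h
      · exact h27 h
      · exact hr (pow_eq_zero_iff (n := 2) (by norm_num) |>.mp h)
    · -- `s = 4`: type `IV*` (Step 8)
      rw [if_neg (by norm_num), if_neg (by norm_num), if_neg (by norm_num), if_pos rfl]
      refine kodairaSymbolOfMinimal_eq_IVstar_of_step8 (dvd0' hIa₁) (dvd0 2 hIa₂) (dvd0 2 hIa₃)
        (dvd0 3 hIa₄) (ha₆k 4 le_rfl) ?_
      have hc : redCoeff I.a₆ 4 ≠ 0 := fun h0 ↦ ha₆n ((redCoeff_eq_zero_iff (ha₆k 4 le_rfl)).mp h0)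
      rw [quadraticStep8, redCoeff_eq_zero_of_dvd (j := 2) (dvd0 3 hIa₃),
        TateAlgorithm.distinctRootCount_sq_add_sub_eq_two_iff]
      have h4k : (4 : IsLocalRing.ResidueField (v.adicCompletionIntegers ℚ)) ≠ 0 := by
        rw [show (4 : IsLocalRing.ResidueField (v.adicCompletionIntegers ℚ)) = 2 * 2 by norm_num]
        exact mul_ne_zero h2k h2k
      intro h
      have : (4 : IsLocalRing.ResidueField (v.adicCompletionIntegers ℚ)) * redCoeff I.a₆ 4 = 0 := by
        linear_combination h
      rcases mul_eq_zero.mp this with h' | h'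
      · exact h4k h'
      · exact hc h'
    · -- `s = 5`: type `II*` (Step 10)
      rw [if_neg (by norm_num), if_neg (by norm_num), if_neg (by norm_num), if_neg (by norm_num)]
      exact kodairaSymbolOfMinimal_eq_IIstar_of_step9 (dvd0' hIa₁) (dvd0 2 hIa₂) (dvd0 3 hIa₃)
        (dvd0 4 hIa₄) (ha₆k 5 le_rfl) ha₆n
  -- read `kodairaSymbolAt` of `W` on the minimal model `X`
  have hrel : X = (D.map (algebraMap ℚ (v.adicCompletion ℚ))) • W.baseChange (v.adicCompletion ℚ) := by
    rw [hX, hM, WeierstrassCurve.baseChange, WeierstrassCurve.baseChange, map_variableChange]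
  rw [W.kodairaSymbolAt_eq_kodairaSymbolOfMinimal_of_isMinimal v X _ hrel X.isUnit_Δ.ne_zero, ← hI]
  exact hK

/-! ### §2 The Kodaira type of a `j = 0` curve at a place `v ∤ 6` -/

/-- **Every elliptic curve over `ℚ` with `j = 0` has, at every place `v ∤ 6`, either good
reduction or Kodaira type `II, IV, I₀*, IV*, II*`** (semistability defect `6, 3, 2, 3, 6`): a short
model `S = C • W` has `a₄ = 0` (`a₄_eq_zero_of_isShortNF_of_j_eq_zero`), i.e. `S : y² = x³ + B`;
rescaling by `ℓ^{6k}` (`ℓ` the residue characteristic) gives `y² = x³ + b` with `ord_v b = s ∈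
{0, …, 5}`: `s = 0` is good reduction (`ord_v Δ = 0`), `s ≥ 1` is `kodairaSymbolAt_of_cubic_model`.
[cite: SilvermanATAEC1994, IV.9.4 and Table 4.1] [cite: SilvermanAEC2009, III.1 and VII.1 Remark 1.1] -/
theorem hasGoodReductionAt_or_kodairaSymbolAt_of_j_eq_zero (W : WeierstrassCurve ℚ) [W.IsElliptic]
    (hj : W.j = 0) (v : HeightOneSpectrum (𝓞 ℚ)) (hv2 : natGenerator v ≠ 2)
    (hv3 : natGenerator v ≠ 3) :
    W.HasGoodReductionAt v ∨ W.kodairaSymbolAt v = .II ∨ W.kodairaSymbolAt v = .IV ∨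
      W.kodairaSymbolAt v = .Istar 0 ∨ W.kodairaSymbolAt v = .IVstar ∨
      W.kodairaSymbolAt v = .IIstar := by
  -- valuations of `2, 3` and of the residue characteristic `ℓ`
  have hp2 : ¬ (natGenerator v : ℤ) ∣ 2 := fun h ↦ hv2 <| by
    have h' : natGenerator v ∣ 2 := by exact_mod_cast h
    exact (Nat.prime_dvd_prime_iff_eq (prime_natGenerator v) Nat.prime_two).mp h'
  have hp3 : ¬ (natGenerator v : ℤ) ∣ 3 := fun h ↦ hv3 <| by
    have h' : natGenerator v ∣ 3 := by exact_mod_cast h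
    exact (Nat.prime_dvd_prime_iff_eq (prime_natGenerator v) Nat.prime_three).mp h'
  have h2 : v.valuation ℚ (2 : ℚ) = 1 := by
    have := Rat.valuation_intCast_eq_one v hp2; exact_mod_cast this
  have h3 : v.valuation ℚ (3 : ℚ) = 1 := by
    have := Rat.valuation_intCast_eq_one v hp3; exact_mod_cast this
  have h432 : v.valuation ℚ (432 : ℚ) = 1 := by
    rw [show (432 : ℚ) = 2 ^ 4 * 3 ^ 3 by norm_num, map_mul, map_pow, map_pow, h2, h3, one_pow,
      one_pow, one_mul]
  have hℓ : v.valuation ℚ (natGenerator v : ℚ) = WithZero.exp (-1 : ℤ) := Rat.valuation_natGenerator v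
  have hℓ0 : (natGenerator v : ℚ) ≠ 0 := by exact_mod_cast (prime_natGenerator v).ne_zero
  -- the short model `y² = x³ + B`
  obtain ⟨C, hC⟩ := W.exists_variableChange_isShortNF
  haveI := hC
  set S := C • W with hSdef
  have hjS : S.j = 0 := by
    show (C • W).j = 0
    rw [variableChange_j, hj]
  have hA : S.a₄ = 0 := a₄_eq_zero_of_isShortNF_of_j_eq_zero S hjS
  set B := S.a₆ with hBdef
  have hB : B ≠ 0 := by
    intro h0
    have hden := four_mul_a₄_cube_add_ne_zero S
    rw [hA, ← hBdef, h0] at hden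
    norm_num at hden
  have hS : S = ⟨0, 0, 0, 0, B⟩ := by
    ext
    · exact S.a₁_of_isShortNF
    · exact S.a₂_of_isShortNF
    · exact S.a₃_of_isShortNF
    · exact hA
    · rfl
  -- `ord_v B = t = 6k + s`
  have hvB0 : v.valuation ℚ B ≠ 0 := (Valuation.ne_zero_iff _).mpr hB
  set t : ℤ := - WithZero.log (v.valuation ℚ B) with ht
  have hvB : v.valuation ℚ B = WithZero.exp (-t) := by
    rw [ht, neg_neg, WithZero.exp_log hvB0]
  obtain ⟨k, s, hs6, hts⟩ : ∃ (k : ℤ) (s : ℕ), s < 6 ∧ t = 6 * k + s :=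
    ⟨t / 6, (t % 6).toNat, by omega, by omega⟩
  -- rescale by `u = ℓ^k`
  set u : ℚˣ := Units.mk0 ((natGenerator v : ℚ) ^ k) (zpow_ne_zero k hℓ0) with hu
  set b : ℚ := ((u⁻¹ : ℚˣ) : ℚ) ^ 6 * B with hb_def
  have hscale : (⟨u, 0, 0, 0⟩ : VariableChange ℚ) • S = ⟨0, 0, 0, 0, b⟩ := by
    rw [hS, smul_cubic_scale]
  have hvu : v.valuation ℚ (((u⁻¹ : ℚˣ) : ℚ) ^ 6) = WithZero.exp (6 * k) := by
    rw [Units.val_inv_eq_inv_val, hu, Units.val_mk0, map_pow, map_inv₀, map_zpow₀, hℓ,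
      ← WithZero.exp_zsmul, ← WithZero.exp_neg, ← WithZero.exp_nsmul]
    congr 1; simp
  have hvb : v.valuation ℚ b = WithZero.exp (-(s : ℤ)) := by
    rw [hb_def, map_mul, hvu, hvB, ← WithZero.exp_add]
    congr 1; omega
  have hM : (⟨0, 0, 0, 0, b⟩ : WeierstrassCurve ℚ) = ((⟨u, 0, 0, 0⟩ : VariableChange ℚ) * C) • W := by
    rw [mul_smul, ← hSdef, hscale]
  rcases Nat.eq_zero_or_pos s with hs0 | hs1
  · -- `s = 0`: good reduction at `v`
    subst hs0
    left
    set M : WeierstrassCurve ℚ := ⟨0, 0, 0, 0, b⟩ with hMdef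
    haveI : M.IsElliptic := by rw [hM]; infer_instance
    have hvb1 : v.valuation ℚ b = 1 := by rw [hvb]; simp
    have hint : M.IsIntegralAt v :=
      M.isIntegralAt_of_valuation_le_one v (by simp [hMdef]) (by simp [hMdef]) (by simp [hMdef])
        (by simp [hMdef]) (by rw [show M.a₆ = b from rfl, hvb1])
    have hΔ1 : v.valuation ℚ M.Δ = 1 := by
      rw [show M.Δ = -(432 : ℚ) * b ^ 2 by
        simp only [hMdef, WeierstrassCurve.Δ, WeierstrassCurve.b₂, WeierstrassCurve.b₄,
          WeierstrassCurve.b₆, WeierstrassCurve.b₈]; ring,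
        map_mul, Valuation.map_neg, h432, one_mul, map_pow, hvb1, one_pow]
    have hmin : M.IsMinimalAt v :=
      isMinimalAt_of_lt_valuation_Δ_holds hint (by rw [hΔ1, ← WithZero.exp_zero]; exact WithZero.exp_lt_exp.mpr (by norm_num))
    have hgoodM : M.HasGoodReductionAt v :=
      (hasGoodReductionAt_iff_of_isMinimalAt (v := v) (W := M) hmin).mpr hΔ1
    rw [hM] at hgoodM
    exact (hasGoodReductionAt_smul_iff_holds v W _).mp hgoodM
  · -- `s ∈ {1, …, 5}`
    right
    have hT := kodairaSymbolAt_of_cubic_model W v hv2 hv3 _ ((⟨u, 0, 0, 0⟩ : VariableChange ℚ) * C)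
      hM rfl hs1 (by omega) hvb
    rcases (show s = 1 ∨ s = 2 ∨ s = 3 ∨ s = 4 ∨ s = 5 by omega) with rfl | rfl | rfl | rfl | rfl <;>
      norm_num at hT <;> simp [hT]

end Summit.BirchSwinnertonDyer.Rank1Residual.X12

end
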